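import Summits.HodgeConjecture.HodgeConjecture.Cruxes.BlochSeedDiscOne.FinCheck

/-!
# CoverShiftUnique — UNIQUE-COVER at the LETTER level, h = 6 (negation g19, pen; `COVER-INTEGRALITY-JOINT.md` v1.4 §C.14 finding (3), kernel half)

F3⁺ (letter uniqueness): a height-2 alphabet letter `q` with NO zero coordinate (`b = (2;±2,±2)`, `r = (2;±3,±1) ∕ (2;±1,±3)`)
has EXACTLY ONE alphabet letter amply below it, namely `shiftLetter q = (0; q.x + sgn q.x, q.y + sgn q.y)` (same signs, each
absolute coordinate + 1); a height-2 letter with a zero coordinate (`q = (2;±4,0) ∕ (2;0,±4)`) has exactly the two letters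
`(0; ±5-with-q's-sign, ±1)` resp. `(0; ±1, ±5)` below it.
BELOW tables of the three stack letters of the UNIQUE-COVER rows (RESIDUAL ATLAS l.11419, finding (3)), as SHAPES:
`BELOW(a = (4;1,1)) = {b, v, m, g}`, `BELOW(k = (3;2,1)) = {m, g, v}`, `BELOW(t = (3;3,0)) = {g, f, u}` — kernel `decide`.
DESIGN LEVEL: under (A4) on the height-6 alphabet, (i) an N cell all of whose letters are height-2 with no zero coordinate
(`b⁴`, `b³r`, `b²r²`, …) has a UNIQUE live cover, the cell `shiftCell y`, and that cell IS PRESENT in `D.suppP`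
(`shiftCell_mem_suppP`) — the (A4) cover row of such a cell is a CELL-LEVEL presence implication `y present ⇒ shiftCell y present`;
(ii) for a 3-stack `y` (height-2 non-zero letters off one slot `f₀`) every live cover agrees with `shiftCell y` off `f₀`
(`cover_eq_shift_off`), so its class is `m³·μ ∕ …` with `μ ∈ BELOW(y f₀)` — with `y f₀ ∈ {a, k, t}` the tables above list μ.
Route: `FinCheck.boxList 6 6` × `FinCheck.upList 6 ℓ` by `decide`, transported by `mem_boxList ∕ mem_upList` (imports `FinCheck`
only; transport helpers re-proved locally). Sorry-free; no `native_decide`; no instances; no notation.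
HONEST FRAMING: finite LETTER-model facts at h = 6 and one-line consequences of `Design.A4`; the cap half of UNIQUE-COVER
(«149∕158 regions admit exactly one cover class for their b-heaviest admissible N stack») is DATA, not proved here; nothing here
proves `FloorFree 6 199 8` ∕ `IntegralityGap.Nonex 14 199 8` ∕ 18881 (`BlochSeedDiscOne`) ∕ H2 ∕ HC_AV ∕ HC_CM ∕ HC. Census-neutral.
-/

set_option linter.dupNamespace false
set_option autoImplicit false

namespace Summit.HodgeConjecture.HodgeConjecture.Cruxes.BlochSeedDiscOne.CoverShiftUnique

open Summit.HodgeConjecture.HodgeConjecture.Cruxes.BlochSeedDiscOne.DepthBoundA4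
open Summit.HodgeConjecture.HodgeConjecture.Cruxes.BlochSeedDiscOne.FinCheck

/-- an alphabet letter is a box letter (transport helper). -/
theorem alphabet_mem_boxList {ℓ : Letter} (hℓ : ℓ.OnAlphabet 6) : ℓ ∈ boxList 6 6 := by
  refine mem_boxList.mpr ⟨hℓ.1, ?_, ?_⟩
  · have e := hℓ.1; have h0 := hℓ.2; unfold Letter.height at e
    have := abs_nonneg ℓ.y; push_cast; omega
  · have e := hℓ.1; have h0 := hℓ.2; unfold Letter.height at e
    have := abs_nonneg ℓ.x; push_cast; omega

/-- letters of N support cells are alphabet letters. -/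
theorem suppN_onAlphabet {D : Design} (hA : D.OnAlphabet 6) {y : Cell} (hy : y ∈ D.suppN) (f : Fin 4) : (y f).OnAlphabet 6 :=
  hA y (List.mem_append.mpr (Or.inl hy)) f

/-- letters of P support cells are alphabet letters. -/
theorem suppP_onAlphabet {D : Design} (hA : D.OnAlphabet 6) {x : Cell} (hx : x ∈ D.suppP) (f : Fin 4) : (x f).OnAlphabet 6 :=
  hA x (List.mem_append.mpr (Or.inr hx)) f

/-- the floor letter forced under a height-2 letter with no zero coordinate: height 0, each coordinate pushed one step away from 0. -/
def shiftLetter (q : Letter) : Letter := ⟨0, q.x + q.x.sign, q.y + q.y.sign⟩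

/-- the cell of forced floor letters under a cell of height-2 letters. -/
def shiftCell (y : Cell) : Cell := fun f => shiftLetter (y f)

set_option maxRecDepth 65536 in
/-- F3⁺, list form: below a height-2 letter with no zero coordinate lies only `shiftLetter` of it (kernel `decide`). -/
theorem f3u_list : ∀ ℓ ∈ boxList 6 6, 0 ≤ ℓ.a → ∀ q ∈ upList 6 ℓ, q.a = 2 → q.x ≠ 0 → q.y ≠ 0 → ℓ = shiftLetter q := by
  decide

set_option maxRecDepth 65536 in
/-- F3⁰ʸ, list form: below `(2;±4,0)` lie exactly the letters `(0; ±5 (same sign), ±1)` (kernel `decide`). -/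
theorem f3y0_list : ∀ ℓ ∈ boxList 6 6, 0 ≤ ℓ.a → ∀ q ∈ upList 6 ℓ, q.a = 2 → q.y = 0 →
    ℓ.a = 0 ∧ ℓ.x = q.x + q.x.sign ∧ (ℓ.y = 1 ∨ ℓ.y = -1) := by
  decide

set_option maxRecDepth 65536 in
/-- F3⁰ˣ, list form: below `(2;0,±4)` lie exactly the letters `(0; ±1, ±5 (same sign))` (kernel `decide`). -/
theorem f3x0_list : ∀ ℓ ∈ boxList 6 6, 0 ≤ ℓ.a → ∀ q ∈ upList 6 ℓ, q.a = 2 → q.x = 0 →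
    ℓ.a = 0 ∧ ℓ.y = q.y + q.y.sign ∧ (ℓ.x = 1 ∨ ℓ.x = -1) := by
  decide

/-- F3⁺ on the alphabet: the floor letter amply below a height-2 letter with no zero coordinate is unique, `= shiftLetter q`. -/
theorem letterFactF3u : ∀ ℓ q : Letter, ℓ.OnAlphabet 6 → q.OnAlphabet 6 → q.a = 2 → q.x ≠ 0 → q.y ≠ 0 →
    AmpleAbove ℓ q → ℓ = shiftLetter q := by
  intro ℓ q hℓ hq ha hx hy hA
  exact f3u_list ℓ (alphabet_mem_boxList hℓ) hℓ.2 q ((mem_upList hℓ).mpr ⟨hq, hA⟩) ha hx hy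

/-- the zero-`y` case on the alphabet: two candidates, both of shape `f = (0;5,1)`. -/
theorem letterFactF3y0 : ∀ ℓ q : Letter, ℓ.OnAlphabet 6 → q.OnAlphabet 6 → q.a = 2 → q.y = 0 →
    AmpleAbove ℓ q → ℓ.a = 0 ∧ ℓ.x = q.x + q.x.sign ∧ (ℓ.y = 1 ∨ ℓ.y = -1) := by
  intro ℓ q hℓ hq ha hy hA
  exact f3y0_list ℓ (alphabet_mem_boxList hℓ) hℓ.2 q ((mem_upList hℓ).mpr ⟨hq, hA⟩) ha hy

/-- the zero-`x` case on the alphabet. -/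
theorem letterFactF3x0 : ∀ ℓ q : Letter, ℓ.OnAlphabet 6 → q.OnAlphabet 6 → q.a = 2 → q.x = 0 →
    AmpleAbove ℓ q → ℓ.a = 0 ∧ ℓ.y = q.y + q.y.sign ∧ (ℓ.x = 1 ∨ ℓ.x = -1) := by
  intro ℓ q hℓ hq ha hx hA
  exact f3x0_list ℓ (alphabet_mem_boxList hℓ) hℓ.2 q ((mem_upList hℓ).mpr ⟨hq, hA⟩) ha hx

/-! ## BELOW tables of the three stack letters `a = (4;1,1)`, `k = (3;2,1)`, `t = (3;3,0)` (as shapes: height and sorted |coords|) -/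

/-- sorted absolute coordinates. -/
abbrev absMax (ℓ : Letter) : ℕ := max ℓ.x.natAbs ℓ.y.natAbs
/-- sorted absolute coordinates. -/
abbrev absMin (ℓ : Letter) : ℕ := min ℓ.x.natAbs ℓ.y.natAbs
/-- `ℓ` has shape `(h; u, w)` = height `h` and sorted absolute coordinates `(u, w)`, `u ≥ w`. -/
abbrev HasShape (ℓ : Letter) (h : ℤ) (u w : ℕ) : Prop := ℓ.a = h ∧ absMax ℓ = u ∧ absMin ℓ = w

set_option maxRecDepth 65536 in
/-- BELOW(a): amply below a letter of shape `(4;1,1)` lie only letters of shapes `b (2;2,2)`, `v (1;3,2)`, `m (0;3,3)`, `g (0;4,2)`. -/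
theorem below_a_list : ∀ ℓ ∈ boxList 6 6, 0 ≤ ℓ.a → ∀ q ∈ upList 6 ℓ, HasShape q 4 1 1 →
    HasShape ℓ 2 2 2 ∨ HasShape ℓ 1 3 2 ∨ HasShape ℓ 0 3 3 ∨ HasShape ℓ 0 4 2 := by
  decide

set_option maxRecDepth 65536 in
/-- BELOW(k): amply below a letter of shape `(3;2,1)` lie only letters of shapes `m (0;3,3)`, `g (0;4,2)`, `v (1;3,2)`. -/
theorem below_k_list : ∀ ℓ ∈ boxList 6 6, 0 ≤ ℓ.a → ∀ q ∈ upList 6 ℓ, HasShape q 3 2 1 →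
    HasShape ℓ 0 3 3 ∨ HasShape ℓ 0 4 2 ∨ HasShape ℓ 1 3 2 := by
  decide

set_option maxRecDepth 65536 in
/-- BELOW(t): amply below a letter of shape `(3;3,0)` lie only letters of shapes `g (0;4,2)`, `f (0;5,1)`, `u (1;4,1)`. -/
theorem below_t_list : ∀ ℓ ∈ boxList 6 6, 0 ≤ ℓ.a → ∀ q ∈ upList 6 ℓ, HasShape q 3 3 0 →
    HasShape ℓ 0 4 2 ∨ HasShape ℓ 0 5 1 ∨ HasShape ℓ 1 4 1 := by
  decide

/-- BELOW(a) on the alphabet. -/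
theorem below_a : ∀ ℓ q : Letter, ℓ.OnAlphabet 6 → q.OnAlphabet 6 → HasShape q 4 1 1 → AmpleAbove ℓ q →
    HasShape ℓ 2 2 2 ∨ HasShape ℓ 1 3 2 ∨ HasShape ℓ 0 3 3 ∨ HasShape ℓ 0 4 2 := by
  intro ℓ q hℓ hq hs hA
  exact below_a_list ℓ (alphabet_mem_boxList hℓ) hℓ.2 q ((mem_upList hℓ).mpr ⟨hq, hA⟩) hs

/-- BELOW(k) on the alphabet. -/
theorem below_k : ∀ ℓ q : Letter, ℓ.OnAlphabet 6 → q.OnAlphabet 6 → HasShape q 3 2 1 → AmpleAbove ℓ q →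
    HasShape ℓ 0 3 3 ∨ HasShape ℓ 0 4 2 ∨ HasShape ℓ 1 3 2 := by
  intro ℓ q hℓ hq hs hA
  exact below_k_list ℓ (alphabet_mem_boxList hℓ) hℓ.2 q ((mem_upList hℓ).mpr ⟨hq, hA⟩) hs

/-- BELOW(t) on the alphabet. -/
theorem below_t : ∀ ℓ q : Letter, ℓ.OnAlphabet 6 → q.OnAlphabet 6 → HasShape q 3 3 0 → AmpleAbove ℓ q →
    HasShape ℓ 0 4 2 ∨ HasShape ℓ 0 5 1 ∨ HasShape ℓ 1 4 1 := by
  intro ℓ q hℓ hq hs hA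
  exact below_t_list ℓ (alphabet_mem_boxList hℓ) hℓ.2 q ((mem_upList hℓ).mpr ⟨hq, hA⟩) hs

/-! ## Design level -/

/-- a cell of height-2 letters with no zero coordinate («bottom, generic»). -/
abbrev BottomGeneric (y : Cell) : Prop := ∀ f : Fin 4, (y f).a = 2 ∧ (y f).x ≠ 0 ∧ (y f).y ≠ 0

/-- (i) cover uniqueness: a live cover of a generic bottom cell IS `shiftCell y`. -/
theorem cover_eq_shiftCell {D : Design} (hA : D.OnAlphabet 6) {x y : Cell} (hx : x ∈ D.suppP) (hy : y ∈ D.suppN)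
    (hb : BottomGeneric y) (hl : Live x y) : x = shiftCell y :=
  funext fun f => letterFactF3u (x f) (y f) (suppP_onAlphabet hA hx f) (suppN_onAlphabet hA hy f)
    (hb f).1 (hb f).2.1 (hb f).2.2 (hl f)

/-- (i′) **CELL-LEVEL PRESENCE IMPLICATION**: under (A4), a present generic bottom N cell forces the single cell `shiftCell y` to be
present on the P side. -/
theorem shiftCell_mem_suppP : ∀ D : Design, D.OnAlphabet 6 → D.A4 → ∀ y ∈ D.suppN, BottomGeneric y → shiftCell y ∈ D.suppP := by
  intro D hA h4 y hy hb
  obtain ⟨x, hx, hl⟩ := h4.2 y hy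
  have e : x = shiftCell y := cover_eq_shiftCell hA hx hy hb hl
  exact e ▸ hx

/-- (ii) 3-stacks: a live cover of a cell whose letters off slot `f₀` are generic bottom letters agrees with `shiftCell y` off `f₀`. -/
theorem cover_eq_shift_off {D : Design} (hA : D.OnAlphabet 6) {x y : Cell} (hx : x ∈ D.suppP) (hy : y ∈ D.suppN) (f₀ : Fin 4)
    (hb : ∀ f : Fin 4, f ≠ f₀ → (y f).a = 2 ∧ (y f).x ≠ 0 ∧ (y f).y ≠ 0) (hl : Live x y) :
    ∀ f : Fin 4, f ≠ f₀ → x f = shiftLetter (y f) :=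
  fun f hf => letterFactF3u (x f) (y f) (suppP_onAlphabet hA hx f) (suppN_onAlphabet hA hy f)
    (hb f hf).1 (hb f hf).2.1 (hb f hf).2.2 (hl f)

/-- (ii′) the `a·b³ ∕ a·b²r ∕ …` stacks: under (A4) such a present N cell has a present P cell equal to `shiftCell y` off the
`a`-slot and of shape `b ∕ v ∕ m ∕ g` at the `a`-slot (BELOW(a)). -/
theorem cover_of_aStack : ∀ D : Design, D.OnAlphabet 6 → D.A4 → ∀ y ∈ D.suppN, ∀ f₀ : Fin 4, HasShape (y f₀) 4 1 1 →
    (∀ f : Fin 4, f ≠ f₀ → (y f).a = 2 ∧ (y f).x ≠ 0 ∧ (y f).y ≠ 0) →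
    ∃ x ∈ D.suppP, (∀ f : Fin 4, f ≠ f₀ → x f = shiftLetter (y f)) ∧
      (HasShape (x f₀) 2 2 2 ∨ HasShape (x f₀) 1 3 2 ∨ HasShape (x f₀) 0 3 3 ∨ HasShape (x f₀) 0 4 2) := by
  intro D hA h4 y hy f₀ hs hb
  obtain ⟨x, hx, hl⟩ := h4.2 y hy
  exact ⟨x, hx, cover_eq_shift_off hA hx hy f₀ hb hl,
    below_a (x f₀) (y f₀) (suppP_onAlphabet hA hx f₀) (suppN_onAlphabet hA hy f₀) hs (hl f₀)⟩

/-- the `k`-stacks (`k·b³`, …): cover = `shiftCell y` off the `k`-slot, shape `m ∕ g ∕ v` at it (BELOW(k)). -/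
theorem cover_of_kStack : ∀ D : Design, D.OnAlphabet 6 → D.A4 → ∀ y ∈ D.suppN, ∀ f₀ : Fin 4, HasShape (y f₀) 3 2 1 →
    (∀ f : Fin 4, f ≠ f₀ → (y f).a = 2 ∧ (y f).x ≠ 0 ∧ (y f).y ≠ 0) →
    ∃ x ∈ D.suppP, (∀ f : Fin 4, f ≠ f₀ → x f = shiftLetter (y f)) ∧
      (HasShape (x f₀) 0 3 3 ∨ HasShape (x f₀) 0 4 2 ∨ HasShape (x f₀) 1 3 2) := by
  intro D hA h4 y hy f₀ hs hb
  obtain ⟨x, hx, hl⟩ := h4.2 y hy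
  exact ⟨x, hx, cover_eq_shift_off hA hx hy f₀ hb hl,
    below_k (x f₀) (y f₀) (suppP_onAlphabet hA hx f₀) (suppN_onAlphabet hA hy f₀) hs (hl f₀)⟩

/-- the `t`-stacks (`t·b³`, …): cover = `shiftCell y` off the `t`-slot, shape `g ∕ f ∕ u` at it (BELOW(t)). -/
theorem cover_of_tStack : ∀ D : Design, D.OnAlphabet 6 → D.A4 → ∀ y ∈ D.suppN, ∀ f₀ : Fin 4, HasShape (y f₀) 3 3 0 →
    (∀ f : Fin 4, f ≠ f₀ → (y f).a = 2 ∧ (y f).x ≠ 0 ∧ (y f).y ≠ 0) →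
    ∃ x ∈ D.suppP, (∀ f : Fin 4, f ≠ f₀ → x f = shiftLetter (y f)) ∧
      (HasShape (x f₀) 0 4 2 ∨ HasShape (x f₀) 0 5 1 ∨ HasShape (x f₀) 1 4 1) := by
  intro D hA h4 y hy f₀ hs hb
  obtain ⟨x, hx, hl⟩ := h4.2 y hy
  exact ⟨x, hx, cover_eq_shift_off hA hx hy f₀ hb hl,
    below_t (x f₀) (y f₀) (suppP_onAlphabet hA hx f₀) (suppN_onAlphabet hA hy f₀) hs (hl f₀)⟩

end Summit.HodgeConjecture.HodgeConjecture.Cruxes.BlochSeedDiscOne.CoverShiftUnique
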